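import Mathlib
import HarnessLib
import Summits.HubbardSuperconductivity.HubbardSuperconductivity.Theorems.KLProgrammeKLRegimeTwoVolumeLastScaleFrameExact
import Summits.HubbardSuperconductivity.HubbardSuperconductivity.Theorems.KLProgrammeKLRegimeTwoVolumeDualRowsTargets

/-!
# Route `KLProgramme` — crux K3 ENGINE (stmt-HubbardSuperconductivity-20437 `KLRegimeEngineV17F2`), stub (e) proof-input «(e)-D-ROWS»: THE FRAME SPLIT OF THE
# SPATIAL DUAL ROW — own-frame comparison = COMMON-FRAME comparison + ONE-VOLUME frame conversion on the fine volume
# (cell gate-hubbard-kl, seat hubbard-kl-k3c4-p1 g26, VL lane; located design points #8 «FRAMES» / #9 «FRAME-FEEDBACK LEDGER», memo DROWS-SCOPE-g26.md §14)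

The (e) closer (`EngineV8.stub_twoLeg_step_of_gridBinderC_dualRows_raise_thr_G`, p609934) reads the spatial dual row `hdualSp` on the RAW two-leg kernels of
`T^{V}(K_V) − 𝒩_{K_V}` (`T^{V}(K) = klEffectiveAction V M β U μ K klE0 n`, `𝒩_K = counterQuadratic V M β K`) with EACH volume at ITS OWN flow frame `K_V = klFlowFrameU V M β U μ n`;
F-D1 (`hdualSp_point_of_pinnedDefect`, p694165) reduces it to PINNED, PHASE-FREE, TIME-SUMMED two-leg defects at a pair of pins.  The two-volume Lipschitz tower of this
lineage (assembly of record `…TwoVolumeLipLawOfRowsBase1Boot`, p729019) compares the volumes at ONE COMMON frame.  This file is the zero-analysis interface between the two: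

* §1 (ONE volume, two frames) **`klEffectiveAction_sub_counterQuadratic_frame_eq`**: from k3c4-p2's resummation identity
  `TwoVolumeDefect.klEffectiveAction_eq_chain_add_map_nearIdentity` (p549694) and `counterQuadratic_fsub`,
  `T(K₂) − 𝒩_{K₂} = (T(K₁) − 𝒩_{K₁}) + ((chain_D − 𝒩_D) + (S_m·effAction_{normalCovariance d}(T(K₁)) − T(K₁)))`, `D = K₂ ⊖ K₁` — the coefficient-1 mismatch `𝒩_D`
  CANCELS in hVL's object `𝒱 − 𝒩_K`; below temperature (`Λ_n ≤ π/β`, in particular at `n = nScales β + 1`) the near-identity step is the identity: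
  `…_of_scale_le_pi_div`, `…_lastScale` (`…TwoVolumeLastScaleFrameExact`);
* §2 (generic) `sectorisedKernel_sub_apply`; **`pinnedDualDefect_le_of_common_add_conversion`** — for raw two-leg kernels of `Xc` (coarse volume) and `Xf`, `Xf′` (fine volume)
  at pins with lifted offsets, both signs: pinned defect of `(Xc, Xf) ≤` pinned defect of `(Xc, Xf′) +` pinned rows of `Xf − Xf′` (triangle inequality, termwise);
* §3 (model) **`hPd_of_commonFrame_add_conversion`** — the `hPd` hypothesis of F-D1 at `(n′, L₁, L₂, M₂)` from (a) the common-frame pinned defect (fine volume at the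
  COARSE frame `K₁ = klFlowFrameU L₁ M₂ β U μ n′`) `≤ Pc σ` and (b) the fine volume's pinned rows of the conversion element `(T^{L₂}(K₂) − 𝒩_{K₂}) − (T^{L₂}(K₁) − 𝒩_{K₁})`
  `≤ Pe σ`, with `Pd σ := Pc σ + Pe σ`; **`hdualSp_point_of_commonFrame_add_conversion`** — composed with F-D1: the body of `hdualSp` at the pins.

Pure bookkeeping (identities + the triangle inequality); nothing about the sizes is asserted; nothing asserts the (D) rows, (e), VL, K3 or superconductivity.
References: BGM 2006 §2.3 (2.21)–(2.24), §2.4 (2.38) [cite: BenfattoGiulianiMastropietro2006]; Feldman–Salmhofer–Trubowitz 1996 §1 (counterterm as a vertex).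
-/

noncomputable section

namespace Summit.HubbardSuperconductivity.HubbardSuperconductivity.Theorems.TwoVolumeDefect

set_option linter.dupNamespace false -- summit = problem name (single-conjunct summit), D-0017

open Finset Complex Literature.MathematicalPhysics.QuantumLattice Literature.Probability.LatticeModels GrassmannAlgebra
open Summit.HubbardSuperconductivity.HubbardSuperconductivity.Theorems.KLRegimeSplit
open Summit.HubbardSuperconductivity.HubbardSuperconductivity.Theorems.KLProgrammeLegKernels
open Summit.HubbardSuperconductivity.HubbardSuperconductivity.Theorems.EngineV8

/-! ## §1 One volume, two frames: the frame conversion of `T(K) − 𝒩_K` -/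

section OneVolume

variable {L M : ℕ} [NeZero L] {β : ℝ} (hβ : 0 < β) (U μ : ℝ) (K₁ K₂ : TrigPolyC4v) (e₀ : ℝ) (n : ℕ)
include hβ

/-- **The frame conversion of `T(K) − 𝒩_K` (one volume, any scale)**: with `D = K₂ ⊖ K₁`, `Ψ_K = uvSymbolCT … K Λ_n`, `κ_D = D(p_k⃗)/(βL²)`, `Ψ̃ = Ψ_{K₂}/(1+Ψ_{K₂}κ_D)`,
`d = Ψ̃ − Ψ_{K₁}`, `m = (1+Ψ_{K₂}κ_D)⁻¹`:
`T(K₂) − 𝒩_{K₂} = (T(K₁) − 𝒩_{K₁}) + ((effAction_{Ψ_{K₂}}(𝒩_D) − 𝒩_D) + (S_m·effAction_{normalCovariance d}(T(K₁)) − T(K₁)))` — k3c4-p2's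
`klEffectiveAction_eq_chain_add_map_nearIdentity` with `𝒩_{K₂} − 𝒩_{K₁} = 𝒩_D` (`counterQuadratic_fsub`): the coefficient-1 mismatch cancels.
[cite: BenfattoGiulianiMastropietro2006, §2.3 (2.21)–(2.24)] -/
theorem klEffectiveAction_sub_counterQuadratic_frame_eq
    (hZ₂ : effPartitionFn ℂ (normalCovariance L M (uvSymbolCT L M β μ K₂ (klScale e₀ n)))
      (hubbardInteraction L M β U + counterQuadratic L M β K₂) ≠ 0)
    (hZ₁ : IsUnit (effPartitionFn ℂ (normalCovariance L M (uvSymbolCT L M β μ K₁ (klScale e₀ n)))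
      (hubbardInteraction L M β U + counterQuadratic L M β K₁))) :
    klEffectiveAction L M β U μ K₂ e₀ n - counterQuadratic L M β K₂ =
      (klEffectiveAction L M β U μ K₁ e₀ n - counterQuadratic L M β K₁) +
        ((effAction ℂ (normalCovariance L M (uvSymbolCT L M β μ K₂ (klScale e₀ n))) (counterQuadratic L M β (fsub K₂ K₁)) -
            counterQuadratic L M β (fsub K₂ K₁)) +
          (ExteriorAlgebra.map (LinearMap.mulLeft ℂ fun X : HubbardFieldIdx L M =>
              (1 + uvSymbolCT L M β μ K₂ (klScale e₀ n) X.1 *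
                (((fsub K₂ K₁).eval (latticeMomentum L X.1.1.2) / (β * (L : ℝ) ^ 2) : ℝ) : ℂ))⁻¹)
            (effAction ℂ (normalCovariance L M fun ks =>
                uvSymbolCT L M β μ K₂ (klScale e₀ n) ks /
                    (1 + uvSymbolCT L M β μ K₂ (klScale e₀ n) ks *
                      (((fsub K₂ K₁).eval (latticeMomentum L ks.1.2) / (β * (L : ℝ) ^ 2) : ℝ) : ℂ)) -
                  uvSymbolCT L M β μ K₁ (klScale e₀ n) ks)
              (klEffectiveAction L M β U μ K₁ e₀ n)) -
            klEffectiveAction L M β U μ K₁ e₀ n)) := by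
  rw [klEffectiveAction_eq_chain_add_map_nearIdentity hβ U μ K₁ K₂ e₀ n hZ₂ hZ₁, counterQuadratic_fsub]
  abel

omit hβ in
/-- **The frame conversion of `T(K) − 𝒩_K` below temperature** (`0 < Λ_n ≤ π/β`): the near-identity step is the identity, so
`T(K₂) − 𝒩_{K₂} = (T(K₁) − 𝒩_{K₁}) + ((effAction_{Ψ_{K₂}}(𝒩_D) − 𝒩_D) + (S_m·T(K₁) − T(K₁)))` — pure algebra (`…LastScaleFrameExact.klEffectiveAction_frame_eq_chain_add_map_of_scale_le_pi_div`).
[cite: BenfattoGiulianiMastropietro2006, §2.3 (2.21)–(2.24)] -/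
theorem klEffectiveAction_sub_counterQuadratic_frame_eq_of_scale_le_pi_div [NeZero M] (hβ : 0 < β)
    (hΛ : 0 < klScale e₀ n) (hΛβ : klScale e₀ n ≤ Real.pi / β)
    (hZ₁ : IsUnit (effPartitionFn ℂ (normalCovariance L M (uvSymbolCT L M β μ K₁ (klScale e₀ n)))
      (hubbardInteraction L M β U + counterQuadratic L M β K₁))) :
    klEffectiveAction L M β U μ K₂ e₀ n - counterQuadratic L M β K₂ =
      (klEffectiveAction L M β U μ K₁ e₀ n - counterQuadratic L M β K₁) +
        ((effAction ℂ (normalCovariance L M (uvSymbolCT L M β μ K₂ (klScale e₀ n))) (counterQuadratic L M β (fsub K₂ K₁)) -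
            counterQuadratic L M β (fsub K₂ K₁)) +
          (ExteriorAlgebra.map (LinearMap.mulLeft ℂ fun X : HubbardFieldIdx L M =>
              (1 + uvSymbolCT L M β μ K₂ (klScale e₀ n) X.1 *
                (((fsub K₂ K₁).eval (latticeMomentum L X.1.1.2) / (β * (L : ℝ) ^ 2) : ℝ) : ℂ))⁻¹)
              (klEffectiveAction L M β U μ K₁ e₀ n) -
            klEffectiveAction L M β U μ K₁ e₀ n)) := by
  rw [klEffectiveAction_frame_eq_chain_add_map_of_scale_le_pi_div hβ U μ K₁ K₂ e₀ n hΛ hΛβ hZ₁, counterQuadratic_fsub]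
  abel

/-- **The frame conversion of `T(K) − 𝒩_K` at the VL reading scale `n = nScales β + 1`** (`e₀ = klE0`; only `0 < β` and the frame-`K₁` partition function a unit).
[cite: BenfattoGiulianiMastropietro2006, §2.3 (2.21)–(2.24)] -/
theorem klEffectiveAction_sub_counterQuadratic_frame_eq_lastScale [NeZero M]
    (hZ₁ : IsUnit (effPartitionFn ℂ (normalCovariance L M (uvSymbolCT L M β μ K₁ (klScale klE0 (nScales β + 1))))
      (hubbardInteraction L M β U + counterQuadratic L M β K₁))) :
    klEffectiveAction L M β U μ K₂ klE0 (nScales β + 1) - counterQuadratic L M β K₂ =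
      (klEffectiveAction L M β U μ K₁ klE0 (nScales β + 1) - counterQuadratic L M β K₁) +
        ((effAction ℂ (normalCovariance L M (uvSymbolCT L M β μ K₂ (klScale klE0 (nScales β + 1)))) (counterQuadratic L M β (fsub K₂ K₁)) -
            counterQuadratic L M β (fsub K₂ K₁)) +
          (ExteriorAlgebra.map (LinearMap.mulLeft ℂ fun X : HubbardFieldIdx L M =>
              (1 + uvSymbolCT L M β μ K₂ (klScale klE0 (nScales β + 1)) X.1 *
                (((fsub K₂ K₁).eval (latticeMomentum L X.1.1.2) / (β * (L : ℝ) ^ 2) : ℝ) : ℂ))⁻¹)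
              (klEffectiveAction L M β U μ K₁ klE0 (nScales β + 1)) -
            klEffectiveAction L M β U μ K₁ klE0 (nScales β + 1))) :=
  klEffectiveAction_sub_counterQuadratic_frame_eq_of_scale_le_pi_div U μ K₁ K₂ klE0 (nScales β + 1) hβ klScale_nScales_succ_pos
    (klScale_nScales_succ_lt hβ).le hZ₁

end OneVolume

/-! ## §2 Generic: the pinned dual defect splits along any intermediate fine object -/

section Generic

variable {Lc Lf M : ℕ} [NeZero Lc] [NeZero Lf]

/-- `sectorisedKernel` of a difference, pointwise (from `sectorisedKernel_add`). [folklore] -/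
theorem sectorisedKernel_sub_apply {N : ℕ} (β : ℝ) (F : Fin N → FreqMomentum Lf M → ℂ) (G G' : HubbardGrassmann Lf M) (m : ℕ)
    (Ω : Fin m → SectorLeg N) (x : Fin m → SpaceTimeIdx Lf M) :
    sectorisedKernel Lf M β F (G - G') m Ω x = sectorisedKernel Lf M β F G m Ω x - sectorisedKernel Lf M β F G' m Ω x := by
  have h := sectorisedKernel_add β F (G - G') G' m
  rw [sub_add_cancel] at h
  have hx := congrFun (congrFun h Ω) x
  simp only [Pi.add_apply] at hx
  rw [hx, add_sub_cancel_right]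

/-- **The pinned two-leg dual defect splits along an intermediate fine object** (triangle inequality, termwise, both offset signs): for raw two-leg kernels
`Wc = sectorisedKernel Lc … Xc 2`, `Wf = … Xf 2`, `Wf′ = … Xf′ 2` at pins `oc`, `of`, a lift `ι : TorusSite 2 Lc → TorusSite 2 Lf` and a leg string `Ω`,
`Σ_{t₁}Σ_ȳ (‖Wc(+ȳ) − Wf(+ιȳ)‖ + ‖Wc(−ȳ) − Wf(−ιȳ)‖) ≤ Σ_{t₁}Σ_ȳ (‖Wc(+ȳ) − Wf′(+ιȳ)‖ + ‖Wc(−ȳ) − Wf′(−ιȳ)‖) + Σ_{t₁}Σ_ȳ (‖(Wf′ − Wf)(+ιȳ)‖ + ‖(Wf′ − Wf)(−ιȳ)‖)`,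
the last kernel being that of `Xf′ − Xf`. [folklore] -/
theorem pinnedDualDefect_le_of_common_add_conversion (β : ℝ) (Xc : HubbardGrassmann Lc M) (Xf Xf' : HubbardGrassmann Lf M)
    (Ω : Fin 2 → SectorLeg 1) (oc : SpaceTimeIdx Lc M) (of : SpaceTimeIdx Lf M) (ι : TorusSite 2 Lc → TorusSite 2 Lf) :
    ∑ t₁ : ImagTimeIdx M, ∑ ybar : TorusSite 2 Lc,
        (‖sectorisedKernel Lc M β (trivialMultiplier Lc M) Xc 2 Ω ![oc, (t₁, oc.2 + ybar)] -
            sectorisedKernel Lf M β (trivialMultiplier Lf M) Xf 2 Ω ![of, (t₁, of.2 + ι ybar)]‖ +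
          ‖sectorisedKernel Lc M β (trivialMultiplier Lc M) Xc 2 Ω ![oc, (t₁, oc.2 + -ybar)] -
            sectorisedKernel Lf M β (trivialMultiplier Lf M) Xf 2 Ω ![of, (t₁, of.2 + -ι ybar)]‖) ≤
      ∑ t₁ : ImagTimeIdx M, ∑ ybar : TorusSite 2 Lc,
          (‖sectorisedKernel Lc M β (trivialMultiplier Lc M) Xc 2 Ω ![oc, (t₁, oc.2 + ybar)] -
              sectorisedKernel Lf M β (trivialMultiplier Lf M) Xf' 2 Ω ![of, (t₁, of.2 + ι ybar)]‖ +
            ‖sectorisedKernel Lc M β (trivialMultiplier Lc M) Xc 2 Ω ![oc, (t₁, oc.2 + -ybar)] -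
              sectorisedKernel Lf M β (trivialMultiplier Lf M) Xf' 2 Ω ![of, (t₁, of.2 + -ι ybar)]‖) +
        ∑ t₁ : ImagTimeIdx M, ∑ ybar : TorusSite 2 Lc,
          (‖sectorisedKernel Lf M β (trivialMultiplier Lf M) (Xf' - Xf) 2 Ω ![of, (t₁, of.2 + ι ybar)]‖ +
            ‖sectorisedKernel Lf M β (trivialMultiplier Lf M) (Xf' - Xf) 2 Ω ![of, (t₁, of.2 + -ι ybar)]‖) := by
  rw [← sum_add_distrib]
  refine sum_le_sum fun t₁ _ => ?_
  rw [← sum_add_distrib]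
  refine sum_le_sum fun ybar _ => ?_
  rw [sectorisedKernel_sub_apply, sectorisedKernel_sub_apply]
  have h₁ := norm_sub_le_norm_sub_add_norm_sub
    (sectorisedKernel Lc M β (trivialMultiplier Lc M) Xc 2 Ω ![oc, (t₁, oc.2 + ybar)])
    (sectorisedKernel Lf M β (trivialMultiplier Lf M) Xf' 2 Ω ![of, (t₁, of.2 + ι ybar)])
    (sectorisedKernel Lf M β (trivialMultiplier Lf M) Xf 2 Ω ![of, (t₁, of.2 + ι ybar)])
  have h₂ := norm_sub_le_norm_sub_add_norm_sub
    (sectorisedKernel Lc M β (trivialMultiplier Lc M) Xc 2 Ω ![oc, (t₁, oc.2 + -ybar)])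
    (sectorisedKernel Lf M β (trivialMultiplier Lf M) Xf' 2 Ω ![of, (t₁, of.2 + -ι ybar)])
    (sectorisedKernel Lf M β (trivialMultiplier Lf M) Xf 2 Ω ![of, (t₁, of.2 + -ι ybar)])
  linarith

end Generic

/-! ## §3 The model: F-D1's `hPd` from the common-frame defect and the fine volume's conversion rows -/

section Model

variable {L₁ L₂ M₂ : ℕ} [NeZero L₁] [NeZero L₂] [NeZero M₂]

/-- **F-D1's pinned hypothesis `hPd` from a COMMON-FRAME pinned defect plus the fine volume's conversion rows.**  At `(n′, L₁, L₂, M₂)`, pins `(oc, of)`, with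
`K₁ = klFlowFrameU L₁ M₂ β U μ n′` (coarse frame), `K₂ = klFlowFrameU L₂ M₂ β U μ n′` (fine frame): if per `σ` (a) the pinned defect of the raw two-leg kernels of
`T^{L₁}(K₁) − 𝒩_{K₁}` and of the fine volume AT THE COARSE FRAME `T^{L₂}(K₁) − 𝒩^{L₂}_{K₁}` is `≤ Pc σ`, and (b) the fine volume's pinned rows (lifted offsets, both signs) of the
conversion element `(T^{L₂}(K₂) − 𝒩_{K₂}) − (T^{L₂}(K₁) − 𝒩^{L₂}_{K₁})` are `≤ Pe σ`, then `hPd` of `hdualSp_point_of_pinnedDefect` holds with `Pd σ := Pc σ + Pe σ`. -/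
theorem hPd_of_commonFrame_add_conversion (β U μ : ℝ) (n' : ℕ) (oc : SpaceTimeIdx L₁ M₂) (of : SpaceTimeIdx L₂ M₂) {Pc Pe : Fin 2 → ℝ}
    (hPc : ∀ σ : Fin 2, ∑ t₁ : ImagTimeIdx M₂, ∑ ybar : TorusSite 2 L₁,
        (‖sectorisedKernel L₁ M₂ β (trivialMultiplier L₁ M₂)
              (klEffectiveAction L₁ M₂ β U μ (klFlowFrameU L₁ M₂ β U μ n') klE0 n' - counterQuadratic L₁ M₂ β (klFlowFrameU L₁ M₂ β U μ n')) 2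
              (![((0, σ), 0), ((0, σ), 1)] : Fin 2 → SectorLeg 1) ![oc, (t₁, oc.2 + ybar)] -
            sectorisedKernel L₂ M₂ β (trivialMultiplier L₂ M₂)
              (klEffectiveAction L₂ M₂ β U μ (klFlowFrameU L₁ M₂ β U μ n') klE0 n' - counterQuadratic L₂ M₂ β (klFlowFrameU L₁ M₂ β U μ n')) 2
              (![((0, σ), 0), ((0, σ), 1)] : Fin 2 → SectorLeg 1) ![of, (t₁, of.2 + Torus.proj L₂ (Torus.cRep ybar))]‖ +
          ‖sectorisedKernel L₁ M₂ β (trivialMultiplier L₁ M₂)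
              (klEffectiveAction L₁ M₂ β U μ (klFlowFrameU L₁ M₂ β U μ n') klE0 n' - counterQuadratic L₁ M₂ β (klFlowFrameU L₁ M₂ β U μ n')) 2
              (![((0, σ), 0), ((0, σ), 1)] : Fin 2 → SectorLeg 1) ![oc, (t₁, oc.2 + -ybar)] -
            sectorisedKernel L₂ M₂ β (trivialMultiplier L₂ M₂)
              (klEffectiveAction L₂ M₂ β U μ (klFlowFrameU L₁ M₂ β U μ n') klE0 n' - counterQuadratic L₂ M₂ β (klFlowFrameU L₁ M₂ β U μ n')) 2
              (![((0, σ), 0), ((0, σ), 1)] : Fin 2 → SectorLeg 1) ![of, (t₁, of.2 + -Torus.proj L₂ (Torus.cRep ybar))]‖) ≤ Pc σ)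
    (hPe : ∀ σ : Fin 2, ∑ t₁ : ImagTimeIdx M₂, ∑ ybar : TorusSite 2 L₁,
        (‖sectorisedKernel L₂ M₂ β (trivialMultiplier L₂ M₂)
              ((klEffectiveAction L₂ M₂ β U μ (klFlowFrameU L₁ M₂ β U μ n') klE0 n' - counterQuadratic L₂ M₂ β (klFlowFrameU L₁ M₂ β U μ n')) -
                (klEffectiveAction L₂ M₂ β U μ (klFlowFrameU L₂ M₂ β U μ n') klE0 n' - counterQuadratic L₂ M₂ β (klFlowFrameU L₂ M₂ β U μ n'))) 2
              (![((0, σ), 0), ((0, σ), 1)] : Fin 2 → SectorLeg 1) ![of, (t₁, of.2 + Torus.proj L₂ (Torus.cRep ybar))]‖ +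
          ‖sectorisedKernel L₂ M₂ β (trivialMultiplier L₂ M₂)
              ((klEffectiveAction L₂ M₂ β U μ (klFlowFrameU L₁ M₂ β U μ n') klE0 n' - counterQuadratic L₂ M₂ β (klFlowFrameU L₁ M₂ β U μ n')) -
                (klEffectiveAction L₂ M₂ β U μ (klFlowFrameU L₂ M₂ β U μ n') klE0 n' - counterQuadratic L₂ M₂ β (klFlowFrameU L₂ M₂ β U μ n'))) 2
              (![((0, σ), 0), ((0, σ), 1)] : Fin 2 → SectorLeg 1) ![of, (t₁, of.2 + -Torus.proj L₂ (Torus.cRep ybar))]‖) ≤ Pe σ)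
    (σ : Fin 2) :
    ∑ t₁ : ImagTimeIdx M₂, ∑ ybar : TorusSite 2 L₁,
        (‖sectorisedKernel L₁ M₂ β (trivialMultiplier L₁ M₂)
              (klEffectiveAction L₁ M₂ β U μ (klFlowFrameU L₁ M₂ β U μ n') klE0 n' - counterQuadratic L₁ M₂ β (klFlowFrameU L₁ M₂ β U μ n')) 2
              (![((0, σ), 0), ((0, σ), 1)] : Fin 2 → SectorLeg 1) ![oc, (t₁, oc.2 + ybar)] -
            sectorisedKernel L₂ M₂ β (trivialMultiplier L₂ M₂)
              (klEffectiveAction L₂ M₂ β U μ (klFlowFrameU L₂ M₂ β U μ n') klE0 n' - counterQuadratic L₂ M₂ β (klFlowFrameU L₂ M₂ β U μ n')) 2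
              (![((0, σ), 0), ((0, σ), 1)] : Fin 2 → SectorLeg 1) ![of, (t₁, of.2 + Torus.proj L₂ (Torus.cRep ybar))]‖ +
          ‖sectorisedKernel L₁ M₂ β (trivialMultiplier L₁ M₂)
              (klEffectiveAction L₁ M₂ β U μ (klFlowFrameU L₁ M₂ β U μ n') klE0 n' - counterQuadratic L₁ M₂ β (klFlowFrameU L₁ M₂ β U μ n')) 2
              (![((0, σ), 0), ((0, σ), 1)] : Fin 2 → SectorLeg 1) ![oc, (t₁, oc.2 + -ybar)] -
            sectorisedKernel L₂ M₂ β (trivialMultiplier L₂ M₂)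
              (klEffectiveAction L₂ M₂ β U μ (klFlowFrameU L₂ M₂ β U μ n') klE0 n' - counterQuadratic L₂ M₂ β (klFlowFrameU L₂ M₂ β U μ n')) 2
              (![((0, σ), 0), ((0, σ), 1)] : Fin 2 → SectorLeg 1) ![of, (t₁, of.2 + -Torus.proj L₂ (Torus.cRep ybar))]‖) ≤ Pc σ + Pe σ :=
  (pinnedDualDefect_le_of_common_add_conversion β _ _ _ _ oc of (fun ybar => Torus.proj L₂ (Torus.cRep ybar))).trans (add_le_add (hPc σ) (hPe σ))

/-- **`hdualSp` AT THE PINS FROM THE COMMON-FRAME DEFECT, THE CONVERSION ROWS AND THE FAR ROWS** — `hPd_of_commonFrame_add_conversion` composed with F-D1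
(`hdualSp_point_of_pinnedDefect`): with `ε·(Pc σ + Pe σ) ≤ Dd/L₁` and `ε·Pf σ ≤ Df/L₁`, the body of `hdualSp` holds at `(oc, of)`. -/
theorem hdualSp_point_of_commonFrame_add_conversion {β : ℝ} (hβ : 0 ≤ β) (U μ : ℝ) (n' : ℕ) (oc : SpaceTimeIdx L₁ M₂) (of : SpaceTimeIdx L₂ M₂)
    (ht : of.1 = oc.1) {Pc Pe Pf : Fin 2 → ℝ} {Dd Df : ℝ}
    (hPc : ∀ σ : Fin 2, ∑ t₁ : ImagTimeIdx M₂, ∑ ybar : TorusSite 2 L₁,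
        (‖sectorisedKernel L₁ M₂ β (trivialMultiplier L₁ M₂)
              (klEffectiveAction L₁ M₂ β U μ (klFlowFrameU L₁ M₂ β U μ n') klE0 n' - counterQuadratic L₁ M₂ β (klFlowFrameU L₁ M₂ β U μ n')) 2
              (![((0, σ), 0), ((0, σ), 1)] : Fin 2 → SectorLeg 1) ![oc, (t₁, oc.2 + ybar)] -
            sectorisedKernel L₂ M₂ β (trivialMultiplier L₂ M₂)
              (klEffectiveAction L₂ M₂ β U μ (klFlowFrameU L₁ M₂ β U μ n') klE0 n' - counterQuadratic L₂ M₂ β (klFlowFrameU L₁ M₂ β U μ n')) 2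
              (![((0, σ), 0), ((0, σ), 1)] : Fin 2 → SectorLeg 1) ![of, (t₁, of.2 + Torus.proj L₂ (Torus.cRep ybar))]‖ +
          ‖sectorisedKernel L₁ M₂ β (trivialMultiplier L₁ M₂)
              (klEffectiveAction L₁ M₂ β U μ (klFlowFrameU L₁ M₂ β U μ n') klE0 n' - counterQuadratic L₁ M₂ β (klFlowFrameU L₁ M₂ β U μ n')) 2
              (![((0, σ), 0), ((0, σ), 1)] : Fin 2 → SectorLeg 1) ![oc, (t₁, oc.2 + -ybar)] -
            sectorisedKernel L₂ M₂ β (trivialMultiplier L₂ M₂)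
              (klEffectiveAction L₂ M₂ β U μ (klFlowFrameU L₁ M₂ β U μ n') klE0 n' - counterQuadratic L₂ M₂ β (klFlowFrameU L₁ M₂ β U μ n')) 2
              (![((0, σ), 0), ((0, σ), 1)] : Fin 2 → SectorLeg 1) ![of, (t₁, of.2 + -Torus.proj L₂ (Torus.cRep ybar))]‖) ≤ Pc σ)
    (hPe : ∀ σ : Fin 2, ∑ t₁ : ImagTimeIdx M₂, ∑ ybar : TorusSite 2 L₁,
        (‖sectorisedKernel L₂ M₂ β (trivialMultiplier L₂ M₂)
              ((klEffectiveAction L₂ M₂ β U μ (klFlowFrameU L₁ M₂ β U μ n') klE0 n' - counterQuadratic L₂ M₂ β (klFlowFrameU L₁ M₂ β U μ n')) -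
                (klEffectiveAction L₂ M₂ β U μ (klFlowFrameU L₂ M₂ β U μ n') klE0 n' - counterQuadratic L₂ M₂ β (klFlowFrameU L₂ M₂ β U μ n'))) 2
              (![((0, σ), 0), ((0, σ), 1)] : Fin 2 → SectorLeg 1) ![of, (t₁, of.2 + Torus.proj L₂ (Torus.cRep ybar))]‖ +
          ‖sectorisedKernel L₂ M₂ β (trivialMultiplier L₂ M₂)
              ((klEffectiveAction L₂ M₂ β U μ (klFlowFrameU L₁ M₂ β U μ n') klE0 n' - counterQuadratic L₂ M₂ β (klFlowFrameU L₁ M₂ β U μ n')) -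
                (klEffectiveAction L₂ M₂ β U μ (klFlowFrameU L₂ M₂ β U μ n') klE0 n' - counterQuadratic L₂ M₂ β (klFlowFrameU L₂ M₂ β U μ n'))) 2
              (![((0, σ), 0), ((0, σ), 1)] : Fin 2 → SectorLeg 1) ![of, (t₁, of.2 + -Torus.proj L₂ (Torus.cRep ybar))]‖) ≤ Pe σ)
    (hPf : ∀ σ : Fin 2, ∑ t₁ : ImagTimeIdx M₂,
        ∑ y ∈ univ.filter (fun y : TorusSite 2 L₂ => Torus.proj L₂ (Torus.cRep (fun i => (((y i).val : ℕ) : ZMod L₁))) ≠ y),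
          (‖sectorisedKernel L₂ M₂ β (trivialMultiplier L₂ M₂)
                (klEffectiveAction L₂ M₂ β U μ (klFlowFrameU L₂ M₂ β U μ n') klE0 n' - counterQuadratic L₂ M₂ β (klFlowFrameU L₂ M₂ β U μ n')) 2
                (![((0, σ), 0), ((0, σ), 1)] : Fin 2 → SectorLeg 1) ![of, (t₁, of.2 + y)]‖ +
            ‖sectorisedKernel L₂ M₂ β (trivialMultiplier L₂ M₂)
                (klEffectiveAction L₂ M₂ β U μ (klFlowFrameU L₂ M₂ β U μ n') klE0 n' - counterQuadratic L₂ M₂ β (klFlowFrameU L₂ M₂ β U μ n')) 2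
                (![((0, σ), 0), ((0, σ), 1)] : Fin 2 → SectorLeg 1) ![of, (t₁, of.2 + -y)]‖) ≤ Pf σ)
    (hDd : ∀ σ, imagTimeWeight β M₂ * (Pc σ + Pe σ) ≤ Dd / L₁) (hDf : ∀ σ, imagTimeWeight β M₂ * Pf σ ≤ Df / L₁) :
    (∀ m ∈ ({omega0 M₂, (omega0 M₂).rev} : Finset (MatsubaraIdx M₂)), ∀ σ : Fin 2, imagTimeWeight β M₂ * ∑ ybar : TorusSite 2 L₁,
        (‖(∑ t₁ : ImagTimeIdx M₂,
              sectorisedKernel L₁ M₂ β (trivialMultiplier L₁ M₂)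
                  (klEffectiveAction L₁ M₂ β U μ (klFlowFrameU L₁ M₂ β U μ n') klE0 n' - counterQuadratic L₁ M₂ β (klFlowFrameU L₁ M₂ β U μ n')) 2
                  (![((0, σ), 0), ((0, σ), 1)] : Fin 2 → SectorLeg 1) ![oc, (t₁, oc.2 + ybar)] *
                Complex.exp (((matsubaraFreq β M₂ m * (imagTime β M₂ oc.1 - imagTime β M₂ t₁) : ℝ) : ℂ) * I)) -
            (∑ t₁ : ImagTimeIdx M₂,
              sectorisedKernel L₂ M₂ β (trivialMultiplier L₂ M₂)
                  (klEffectiveAction L₂ M₂ β U μ (klFlowFrameU L₂ M₂ β U μ n') klE0 n' - counterQuadratic L₂ M₂ β (klFlowFrameU L₂ M₂ β U μ n')) 2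
                  (![((0, σ), 0), ((0, σ), 1)] : Fin 2 → SectorLeg 1) ![of, (t₁, of.2 + Torus.proj L₂ (Torus.cRep ybar))] *
                Complex.exp (((matsubaraFreq β M₂ m * (imagTime β M₂ of.1 - imagTime β M₂ t₁) : ℝ) : ℂ) * I))‖ +
          ‖(∑ t₁ : ImagTimeIdx M₂,
              sectorisedKernel L₁ M₂ β (trivialMultiplier L₁ M₂)
                  (klEffectiveAction L₁ M₂ β U μ (klFlowFrameU L₁ M₂ β U μ n') klE0 n' - counterQuadratic L₁ M₂ β (klFlowFrameU L₁ M₂ β U μ n')) 2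
                  (![((0, σ), 0), ((0, σ), 1)] : Fin 2 → SectorLeg 1) ![oc, (t₁, oc.2 + -ybar)] *
                Complex.exp (((matsubaraFreq β M₂ m * (imagTime β M₂ oc.1 - imagTime β M₂ t₁) : ℝ) : ℂ) * I)) -
            (∑ t₁ : ImagTimeIdx M₂,
              sectorisedKernel L₂ M₂ β (trivialMultiplier L₂ M₂)
                  (klEffectiveAction L₂ M₂ β U μ (klFlowFrameU L₂ M₂ β U μ n') klE0 n' - counterQuadratic L₂ M₂ β (klFlowFrameU L₂ M₂ β U μ n')) 2
                  (![((0, σ), 0), ((0, σ), 1)] : Fin 2 → SectorLeg 1) ![of, (t₁, of.2 + -Torus.proj L₂ (Torus.cRep ybar))] *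
                Complex.exp (((matsubaraFreq β M₂ m * (imagTime β M₂ of.1 - imagTime β M₂ t₁) : ℝ) : ℂ) * I))‖) ≤ Dd / L₁) ∧
    (∀ m ∈ ({omega0 M₂, (omega0 M₂).rev} : Finset (MatsubaraIdx M₂)), ∀ σ : Fin 2, imagTimeWeight β M₂ *
        ∑ y ∈ univ.filter (fun y : TorusSite 2 L₂ => Torus.proj L₂ (Torus.cRep (fun i => (((y i).val : ℕ) : ZMod L₁))) ≠ y),
          (‖(∑ t₁ : ImagTimeIdx M₂,
              sectorisedKernel L₂ M₂ β (trivialMultiplier L₂ M₂)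
                  (klEffectiveAction L₂ M₂ β U μ (klFlowFrameU L₂ M₂ β U μ n') klE0 n' - counterQuadratic L₂ M₂ β (klFlowFrameU L₂ M₂ β U μ n')) 2
                  (![((0, σ), 0), ((0, σ), 1)] : Fin 2 → SectorLeg 1) ![of, (t₁, of.2 + y)] *
                Complex.exp (((matsubaraFreq β M₂ m * (imagTime β M₂ of.1 - imagTime β M₂ t₁) : ℝ) : ℂ) * I))‖ +
            ‖(∑ t₁ : ImagTimeIdx M₂,
              sectorisedKernel L₂ M₂ β (trivialMultiplier L₂ M₂)
                  (klEffectiveAction L₂ M₂ β U μ (klFlowFrameU L₂ M₂ β U μ n') klE0 n' - counterQuadratic L₂ M₂ β (klFlowFrameU L₂ M₂ β U μ n')) 2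
                  (![((0, σ), 0), ((0, σ), 1)] : Fin 2 → SectorLeg 1) ![of, (t₁, of.2 + -y)] *
                Complex.exp (((matsubaraFreq β M₂ m * (imagTime β M₂ of.1 - imagTime β M₂ t₁) : ℝ) : ℂ) * I))‖) ≤ Df / L₁) :=
  hdualSp_point_of_pinnedDefect hβ U μ n' oc of ht (Pd := fun σ => Pc σ + Pe σ) (hPd_of_commonFrame_add_conversion β U μ n' oc of hPc hPe) hPf hDd hDf

end Model

end Summit.HubbardSuperconductivity.HubbardSuperconductivity.Theorems.TwoVolumeDefect

end
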